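import Literature.Computability.QuantumComplexity.CliffordTPathSums
import Literature.Computability.QuantumComplexity.ForrelationThm25Sign
import Literature.Computability.QuantumComplexity.StabilizerRank
import HarnessLib

/-!
# Aaronson–Ambainis Lemma 24 over the sign basis, I: catalytic `T` gates from one magic state

Topic `Literature/Computability/QuantumComplexity`; first file of the discharge of the named fact
`AaronsonAmbainis2018_lemma24_sign_hard` (`QSimSign.lean`: every `PromiseBQP` problem Karp-reduces
to QSIM over the sign basis `{H, Z, CZ, CCZ}`; S. Aaronson, A. Ambainis, *Forrelation*, SIAM J.
Comput. 47 (2018) = arXiv:1411.5729, §6, Lemma 24, p. 26: "follows from Shi [{H, Toffoli} is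
universal]"), i.e. of the hardness half of the `PromiseBQP`-completeness of explicit `k`-fold
FORRELATION (`ForrelationComplete.lean`; the reduction QSIM `≤ₚ` FORRELATION of Thm. 25 is proved in
`ForrelationThm25EncodeFP.lean`, and the assembly `aaronson_ambainis_kForrelation_complete_of_mem_of_hard`
awaits exactly the membership fact and this hardness fact).

## Why the reduction cannot be exact, and the route taken

The tree's `PromiseBQP` is over Clifford+`T` (`{H, S, T, CNOT}`, complex amplitudes), QSIM is over
the real sign basis. Every matrix computed by a sign-basis circuit has the form `M/√2^k` with `M`
an integer matrix (Amy–Glaudell–Ross 2020, the "Toffoli–Hadamard" operators; for three qubits see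
Amy–Ross–Wesley, arXiv:2407.11152, §2: `TofH(n)`), so all amplitudes reachable from `|0…0⟩` are
either all dyadic rationals or all dyadic multiples of `√2`, with any number of clean ancillas.
Controlled-Hadamard type gates (entries `1` and `1/√2` at once) and the acceptance probabilities of
Clifford+`T` circuits (e.g. `(2 + √2)/4` for `H T H`) are of mixed type, so no exact gate-by-gate
translation and no exact encoding of the acceptance probability as a sign amplitude exists; an
approximation step is unavoidable. We confine it to ONE fixed two-qubit state, as follows
(standard realification, Bernstein–Vazirani 1997, §8 / Adleman–DeMarrais–Huang 1997; magic-state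
injection of the `T` gate, Nielsen–Chuang 2010, §10.6.2 with Ex. 10.68, here in its *catalytic*
form):

* realification with one global wire `ρ` (real and imaginary part) makes `H`, `CNOT` and the
  inputs exact and turns `S = diag(1, i)` into the controlled real quarter turn `J = XZ`, an exact
  sign-basis word (`CX · CZ`), and the controlled-`S` gate into `CCX · CCZ` (file II);
* **this file**: the `T` gate is applied *catalytically* — with one catalyst qubit `a` in the
  magic state `|A⟩ = (|0⟩ + ω|1⟩)/√2`, `ω = e^{iπ/4}`, the two-gate word "CNOT from the data qubit
  `q` onto `a`, then controlled-`S` on `q, a`" maps `|ψ⟩|A⟩ ↦ T|ψ⟩|A⟩` EXACTLY and returns the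
  catalyst (`inject_mul_projAAt`), while on the orthogonal catalyst state
  `|A⊥⟩ = (|0⟩ − ω|1⟩)/√2` it acts as `ZT` (`inject_mul_projAperpAt`); both gates of the word realify
  exactly, so the only inexact ingredient of the whole reduction is the preparation of (the
  realification of) `|A⟩`, a fixed state, approximated once by a fixed sign-basis gadget (file III);
  the error does not accumulate: the computation splits into the `|A⟩`-branch (correct) and the
  `|A⊥⟩`-branch (every `T` replaced by `ZT`), weighted by the gadget's overlap;
* the acceptance probability is then read as a single sign amplitude by Bennett's copy trick and the
  `2/3` vs `1/3` gap is amplified by independent repetitions (later files).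

## Contents (all proved)

* `ketA` (the tree's `magicT = T H |0⟩`, `StabilizerRank.lean`), `ketAperp` — the magic state and its
  orthogonal complement on `QReg 1`; `projA`, `projAperp`
  — the rank-one projectors `|A⟩⟨A|`, `|A⊥⟩⟨A⊥|` with `projA + projAperp = 1`, idempotence,
  orthogonality, self-adjointness;
* `csGate` — the controlled-`S` gate `diag(1, 1, 1, i)` on `QReg 2`; `inject q a` — the injection
  word on wires `q ≠ a` of an `N`-wire register (CNOT `q → a`, then controlled-`S`), as a matrix;
* **the catalysis identities** `injectTwo_mul_projA`, `injectTwo_mul_projAperp` on two qubits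
  (a `4 × 4` computation transported along `qRegTwoEquiv`) and their placed forms
  `inject_mul_projAAt : inject q a h * Π_A(a) = T_q * Π_A(a)`,
  `inject_mul_projAperpAt : inject q a h * Π_⊥(a) = (Z T)_q * Π_⊥(a)`;
* `prod_mul_eq_mul_prod_of_forall₂` — the bookkeeping lemma turning the gate-by-gate identities
  `M Π = Π N` into the circuit-level identity `(∏ M) Π = Π (∏ N)` (the projector `Π_A(a)` commutes
  with every operator placed off the wire `a`, `placeGate_comm_wire`).

## References

* S. Aaronson, A. Ambainis, *Forrelation: a problem that optimally separates quantum from classical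
  computing*, SIAM J. Comput. 47 (2018) 982–1038; arXiv:1411.5729, §6, Lemma 24 (p. 26).
* M. A. Nielsen, I. L. Chuang, *Quantum Computation and Quantum Information*, CUP 2010, §4.2
  (`S`, `T`), §4.3 (controlled gates), §10.6.2 and Ex. 10.68 (the `T` gate from the state
  `(|0⟩ + e^{iπ/4}|1⟩)/√2`, a CNOT and a classically controlled `S` correction).
* E. Bernstein, U. Vazirani, *Quantum complexity theory*, SIAM J. Comput. 26 (1997), §8.
* M. Amy, A. N. Glaudell, N. J. Ross, *Number-theoretic characterizations of some restricted
  Clifford+T circuits*, Quantum 4 (2020) 252; M. Amy, N. J. Ross, S. Wesley, arXiv:2407.11152, §2.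
-/

noncomputable section

namespace Literature.Computability.QuantumComplexity

open Matrix _root_.Computability Complexity Cryptography Finset

namespace Lemma24

variable {N : ℕ}

/-! ### One-qubit matrices and the constants `1/√2`, `ω` -/

/-- A one-qubit matrix is determined by its four entries. [folklore] -/
theorem matrix_qReg_one_ext {M M' : Matrix (QReg 1) (QReg 1) ℂ}
    (h : ∀ a b : Bool, M (fun _ => a) (fun _ => b) = M' (fun _ => a) (fun _ => b)) : M = M' := by
  ext x y
  have hx : x = fun _ => x 0 := funext fun i => by rw [Subsingleton.elim i 0]
  have hy : y = fun _ => y 0 := funext fun i => by rw [Subsingleton.elim i 0]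
  rw [hx, hy]; exact h _ _

/-- `1/√2` is real: `star (1/√2) = 1/√2`. [folklore] -/
@[simp] theorem star_invSqrt2 : star invSqrt2 = invSqrt2 := by
  simp [invSqrt2]

/-- `ω̄ ω = 1`. [folklore] -/
theorem star_omega_mul_omega : star omega * omega = 1 := by
  rw [mul_comm, omega_mul_star]

/-- `ω⁷ ω = 1`. [folklore] -/
theorem omega_pow_seven_mul_omega : omega ^ 7 * omega = 1 := by
  rw [← pow_succ, omega_pow_eight]

/-- `ω ω⁷ = 1`. [folklore] -/
theorem omega_mul_omega_pow_seven : omega * omega ^ 7 = 1 := by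
  rw [mul_comm, omega_pow_seven_mul_omega]

/-! ### The magic state and its projectors -/

/-- The magic state `|A⟩ = (|0⟩ + ω|1⟩)/√2` of the `T` gate (`ω = e^{iπ/4}`) is the tree's
`magicT = T H |0⟩` (`StabilizerRank.lean`); `ketA` is a local name for it. [cite: NielsenChuang2010, §10.6.2] -/
abbrev ketA : QReg 1 → ℂ := magicT

/-- The amplitudes of `|A⟩ = T H |0⟩`: `1/√2` at `0`, `ω/√2` at `1`. [cite: NielsenChuang2010, §10.6.2] -/
theorem ketA_apply (b : QReg 1) : ketA b = if b 0 then omega * invSqrt2 else invSqrt2 := by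
  change (tGate *ᵥ (hGate *ᵥ zeroState 1)) b = _
  have hz : ∀ c : Bool, zeroState 1 (fun _ : Fin 1 => c) = if c then 0 else 1 := fun c => by
    cases c <;> simp [zeroState, basisState_apply, funext_iff]
  have hb : b = fun _ => b 0 := funext fun i => by rw [Subsingleton.elim i 0]
  rw [hb]
  simp only [Matrix.mulVec, dotProduct, sum_qReg_one, Fintype.sum_bool, hz]
  cases b 0 <;> simp [tGate, hGate, funext_iff, invSqrt2]

/-- The orthogonal magic state `|A⊥⟩ = (|0⟩ − ω|1⟩)/√2`. [cite: NielsenChuang2010, §10.6.2] -/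
def ketAperp : QReg 1 → ℂ := fun b => if b 0 then -(omega * invSqrt2) else invSqrt2

/-- `|A⟩` at `0`. [folklore] -/
@[simp] theorem ketA_false : ketA (fun _ => false) = invSqrt2 := by rw [ketA_apply]; rfl
/-- `|A⟩` at `1`. [folklore] -/
@[simp] theorem ketA_true : ketA (fun _ => true) = omega * invSqrt2 := by rw [ketA_apply]; rfl
/-- `|A⊥⟩` at `0`. [folklore] -/
@[simp] theorem ketAperp_false : ketAperp (fun _ => false) = invSqrt2 := by simp [ketAperp]
/-- `|A⊥⟩` at `1`. [folklore] -/
@[simp] theorem ketAperp_true : ketAperp (fun _ => true) = -(omega * invSqrt2) := by simp [ketAperp]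

/-- The rank-one projector `|A⟩⟨A|`. [cite: NielsenChuang2010, §2.1.6] -/
def projA : Matrix (QReg 1) (QReg 1) ℂ := Matrix.of fun x y => ketA x * star (ketA y)

/-- The rank-one projector `|A⊥⟩⟨A⊥|`. [cite: NielsenChuang2010, §2.1.6] -/
def projAperp : Matrix (QReg 1) (QReg 1) ℂ := Matrix.of fun x y => ketAperp x * star (ketAperp y)

/-- Entries of `|A⟩⟨A|`: `½ ω^{[x]} ω̄^{[y]}` with `ω̄ = ω⁷`. [cite: NielsenChuang2010, §10.6.2] -/
theorem projA_apply (x y : QReg 1) :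
    projA x y = (1 / 2 : ℂ) * ((if x 0 then omega else 1) * (if y 0 then omega ^ 7 else 1)) := by
  rw [← invSqrt2_mul_invSqrt2, ← star_omega]
  simp only [projA, Matrix.of_apply, ketA_apply]
  cases x 0 <;> cases y 0 <;> simp [star_mul'] <;> ring

/-- Entries of `|A⊥⟩⟨A⊥|`. [cite: NielsenChuang2010, §10.6.2] -/
theorem projAperp_apply (x y : QReg 1) :
    projAperp x y = (1 / 2 : ℂ) * ((if x 0 then -omega else 1) * (if y 0 then -omega ^ 7 else 1)) := by
  rw [← invSqrt2_mul_invSqrt2, ← star_omega]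
  simp only [projAperp, Matrix.of_apply, ketAperp]
  cases x 0 <;> cases y 0 <;> simp [star_mul'] <;> ring

/-- **Completeness `|A⟩⟨A| + |A⊥⟩⟨A⊥| = 1`.** [cite: NielsenChuang2010, §2.1.6 (completeness relation)] -/
theorem projA_add_projAperp : projA + projAperp = 1 := by
  refine matrix_qReg_one_ext fun a b => ?_
  rw [Matrix.add_apply, projA_apply, projAperp_apply, Matrix.one_apply]
  cases a <;> cases b <;> simp [funext_iff, omega_mul_omega_pow_seven] <;> norm_num

/-- `|A⟩⟨A|` is self-adjoint. [cite: NielsenChuang2010, §2.1.6] -/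
theorem projA_conjTranspose : projAᴴ = projA := by
  ext x y; simp [projA, Matrix.conjTranspose_apply, mul_comm]

/-- `|A⊥⟩⟨A⊥|` is self-adjoint. [cite: NielsenChuang2010, §2.1.6] -/
theorem projAperp_conjTranspose : projAperpᴴ = projAperp := by
  ext x y; simp [projAperp, Matrix.conjTranspose_apply, mul_comm]

/-- `⟨A|A⟩ = 1`. [cite: NielsenChuang2010, §10.6.2] -/
theorem sum_star_ketA_mul_ketA : ∑ b : QReg 1, star (ketA b) * ketA b = 1 := by
  rw [sum_qReg_one, Fintype.sum_bool, ketA_false, ketA_true, star_mul', star_invSqrt2]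
  calc star omega * invSqrt2 * (omega * invSqrt2) + invSqrt2 * invSqrt2
      = (1 + star omega * omega) * (invSqrt2 * invSqrt2) := by ring
    _ = 1 := by rw [star_omega_mul_omega, invSqrt2_mul_invSqrt2]; norm_num

/-- `⟨A⊥|A⊥⟩ = 1`. [cite: NielsenChuang2010, §10.6.2] -/
theorem sum_star_ketAperp_mul_ketAperp : ∑ b : QReg 1, star (ketAperp b) * ketAperp b = 1 := by
  rw [sum_qReg_one, Fintype.sum_bool, ketAperp_false, ketAperp_true, star_neg, star_mul', star_invSqrt2]
  calc -(star omega * invSqrt2) * -(omega * invSqrt2) + invSqrt2 * invSqrt2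
      = (1 + star omega * omega) * (invSqrt2 * invSqrt2) := by ring
    _ = 1 := by rw [star_omega_mul_omega, invSqrt2_mul_invSqrt2]; norm_num

/-- `⟨A|A⊥⟩ = 0`. [cite: NielsenChuang2010, §10.6.2] -/
theorem sum_star_ketA_mul_ketAperp : ∑ b : QReg 1, star (ketA b) * ketAperp b = 0 := by
  rw [sum_qReg_one, Fintype.sum_bool, ketA_false, ketA_true, ketAperp_false, ketAperp_true, star_mul',
    star_invSqrt2]
  calc star omega * invSqrt2 * -(omega * invSqrt2) + invSqrt2 * invSqrt2
      = (1 - star omega * omega) * (invSqrt2 * invSqrt2) := by ring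
    _ = 0 := by rw [star_omega_mul_omega]; ring

/-- `⟨A⊥|A⟩ = 0`. [cite: NielsenChuang2010, §10.6.2] -/
theorem sum_star_ketAperp_mul_ketA : ∑ b : QReg 1, star (ketAperp b) * ketA b = 0 := by
  have h := congrArg star sum_star_ketA_mul_ketAperp
  rw [star_sum, star_zero] at h
  rw [← h]
  exact Finset.sum_congr rfl fun b _ => by rw [star_mul', star_star, mul_comm]

/-- `|A⟩⟨A|` is idempotent. [cite: NielsenChuang2010, §2.1.6] -/
theorem projA_mul_projA : projA * projA = projA := by
  ext x y
  rw [Matrix.mul_apply]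
  have : ∀ z, projA x z * projA z y = ketA x * star (ketA y) * (star (ketA z) * ketA z) := fun z => by
    simp only [projA, Matrix.of_apply]; ring
  simp_rw [this]
  rw [← Finset.mul_sum, sum_star_ketA_mul_ketA, mul_one]; rfl

/-- `|A⊥⟩⟨A⊥|` is idempotent. [cite: NielsenChuang2010, §2.1.6] -/
theorem projAperp_mul_projAperp : projAperp * projAperp = projAperp := by
  ext x y
  rw [Matrix.mul_apply]
  have : ∀ z, projAperp x z * projAperp z y =
      ketAperp x * star (ketAperp y) * (star (ketAperp z) * ketAperp z) := fun z => by
    simp only [projAperp, Matrix.of_apply]; ring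
  simp_rw [this]
  rw [← Finset.mul_sum, sum_star_ketAperp_mul_ketAperp, mul_one]; rfl

/-- `|A⟩⟨A| · |A⊥⟩⟨A⊥| = 0`. [cite: NielsenChuang2010, §2.1.6] -/
theorem projA_mul_projAperp : projA * projAperp = 0 := by
  ext x y
  rw [Matrix.mul_apply]
  have : ∀ z, projA x z * projAperp z y =
      ketA x * star (ketAperp y) * (star (ketA z) * ketAperp z) := fun z => by
    simp only [projA, projAperp, Matrix.of_apply]; ring
  simp_rw [this]
  rw [← Finset.mul_sum, sum_star_ketA_mul_ketAperp, mul_zero]; rfl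

/-- `|A⊥⟩⟨A⊥| · |A⟩⟨A| = 0`. [cite: NielsenChuang2010, §2.1.6] -/
theorem projAperp_mul_projA : projAperp * projA = 0 := by
  ext x y
  rw [Matrix.mul_apply]
  have : ∀ z, projAperp x z * projA z y =
      ketAperp x * star (ketA y) * (star (ketAperp z) * ketA z) := fun z => by
    simp only [projA, projAperp, Matrix.of_apply]; ring
  simp_rw [this]
  rw [← Finset.mul_sum, sum_star_ketAperp_mul_ketA, mul_zero]; rfl

/-! ### The controlled-`S` gate and the injection word -/

/-- The controlled-`S` gate `diag(1, 1, 1, i)` on two qubits (symmetric in the two wires).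
[cite: NielsenChuang2010, §4.3 (controlled phase gates)] -/
def csGate : Matrix (QReg 2) (QReg 2) ℂ :=
  Matrix.of fun x y => if x = y then (if x 0 = true ∧ x 1 = true then Complex.I else 1) else 0

/-- The `T` gate placed on the first of two wires. [cite: NielsenChuang2010, §4.2] -/
abbrev tFirst : Matrix (QReg 2) (QReg 2) ℂ := placeGate (wireEmb (0 : Fin 2)) tGate

/-- `Z T` placed on the first of two wires. [cite: NielsenChuang2010, §4.2] -/
abbrev ztFirst : Matrix (QReg 2) (QReg 2) ℂ := placeGate (wireEmb (0 : Fin 2)) (pauliZ * tGate)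

/-- A one-qubit operator placed on the second of two wires. [cite: NielsenChuang2010, §4.3] -/
abbrev onSecond (P : Matrix (QReg 1) (QReg 1) ℂ) : Matrix (QReg 2) (QReg 2) ℂ :=
  placeGate (wireEmb (1 : Fin 2)) P

/-- **The injection word on two qubits** (data `q` = wire `0`, catalyst `a` = wire `1`): CNOT with
control `q` and target `a`, then controlled-`S`. [cite: NielsenChuang2010, §10.6.2 and Ex. 10.68] -/
def injectTwo : Matrix (QReg 2) (QReg 2) ℂ := csGate * cnot

/-! ### The `4 × 4` computation (basis order `|00⟩, |01⟩, |10⟩, |11⟩`, `|q a⟩`) -/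

/-- `csGate · cnot` as an explicit matrix (rows `[1,0,0,0; 0,1,0,0; 0,0,0,1; 0,0,i,0]`, `i = ω²`).
[cite: NielsenChuang2010, §4.3] -/
theorem reindex_injectTwo :
    Matrix.reindex qRegTwoEquiv qRegTwoEquiv injectTwo =
      !![1, 0, 0, 0; 0, 1, 0, 0; 0, 0, 0, 1; 0, 0, omega ^ 2, 0] := by
  have hcs : Matrix.reindex qRegTwoEquiv qRegTwoEquiv csGate =
      !![1, 0, 0, 0; 0, 1, 0, 0; 0, 0, 1, 0; 0, 0, 0, Complex.I] := by
    ext i j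
    fin_cases i <;> fin_cases j <;> simp [qRegTwoEquiv, csGate, funext_iff, Fin.forall_fin_two]
  have hcn : Matrix.reindex qRegTwoEquiv qRegTwoEquiv cnot =
      !![1, 0, 0, 0; 0, 1, 0, 0; 0, 0, 0, 1; 0, 0, 1, 0] := by
    ext i j
    fin_cases i <;> fin_cases j <;> simp [qRegTwoEquiv, cnot]
  have hmul : Matrix.reindex qRegTwoEquiv qRegTwoEquiv injectTwo =
      Matrix.reindex qRegTwoEquiv qRegTwoEquiv csGate * Matrix.reindex qRegTwoEquiv qRegTwoEquiv cnot := by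
    rw [injectTwo]
    exact (map_mul (Matrix.reindexRingEquiv ℂ qRegTwoEquiv) csGate cnot)
  rw [hmul, hcs, hcn, omega_pow_two]
  ext i j
  fin_cases i <;> fin_cases j <;> simp [Matrix.mul_apply, Fin.sum_univ_four]

/-- A one-qubit operator on the second wire, explicitly: `1 ⊗ P`. [cite: NielsenChuang2010, §4.3] -/
theorem reindex_onSecond (P : Matrix (QReg 1) (QReg 1) ℂ) :
    Matrix.reindex qRegTwoEquiv qRegTwoEquiv (onSecond P) =
      !![P (fun _ => false) (fun _ => false), P (fun _ => false) (fun _ => true), 0, 0;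
         P (fun _ => true) (fun _ => false), P (fun _ => true) (fun _ => true), 0, 0;
         0, 0, P (fun _ => false) (fun _ => false), P (fun _ => false) (fun _ => true);
         0, 0, P (fun _ => true) (fun _ => false), P (fun _ => true) (fun _ => true)] := by
  have hcomp : ∀ x : QReg 2, x ∘ wireEmb (1 : Fin 2) = fun _ => x 1 := fun x => funext fun _ => by simp
  ext i j
  fin_cases i <;> fin_cases j <;>
    simp [qRegTwoEquiv, placeGate_apply, range_wireEmb, Fin.forall_fin_two, hcomp]

/-- A diagonal one-qubit operator `diag(u₀, u₁)` on the first wire, explicitly: `diag(u₀,u₀,u₁,u₁)`.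
[cite: NielsenChuang2010, §4.3] -/
theorem reindex_onFirst_diag (U : Matrix (QReg 1) (QReg 1) ℂ)
    (hU : ∀ x y : QReg 1, x ≠ y → U x y = 0) :
    Matrix.reindex qRegTwoEquiv qRegTwoEquiv (placeGate (wireEmb (0 : Fin 2)) U) =
      !![U (fun _ => false) (fun _ => false), 0, 0, 0;
         0, U (fun _ => false) (fun _ => false), 0, 0;
         0, 0, U (fun _ => true) (fun _ => true), 0;
         0, 0, 0, U (fun _ => true) (fun _ => true)] := by
  have hcomp : ∀ x : QReg 2, x ∘ wireEmb (0 : Fin 2) = fun _ => x 0 := fun x => funext fun _ => by simp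
  have h01 : U (fun _ => false) (fun _ => true) = 0 := hU _ _ (fun h => by simpa using congrFun h 0)
  have h10 : U (fun _ => true) (fun _ => false) = 0 := hU _ _ (fun h => by simpa using congrFun h 0)
  ext i j
  fin_cases i <;> fin_cases j <;>
    simp [qRegTwoEquiv, placeGate_apply, range_wireEmb, Fin.forall_fin_two, hcomp, h01, h10]

/-- Entries of `T`. [cite: NielsenChuang2010, §4.2] -/
theorem tGate_apply_const (a b : Bool) :
    tGate (fun _ : Fin 1 => a) (fun _ => b) = if a = b then (if a then omega else 1) else 0 := by
  cases a <;> cases b <;> simp [tGate, funext_iff]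

/-- Entries of `Z T = diag(1, -ω)`. [cite: NielsenChuang2010, §4.2] -/
theorem pauliZ_mul_tGate_apply_const (a b : Bool) :
    (pauliZ * tGate) (fun _ : Fin 1 => a) (fun _ => b) = if a = b then (if a then -omega else 1) else 0 := by
  rw [Matrix.mul_apply, sum_qReg_one, Fintype.sum_bool]
  cases a <;> cases b <;> simp [tGate, pauliZ, funext_iff]

/-- `T` is diagonal. [cite: NielsenChuang2010, §4.2] -/
theorem tGate_off_diag (x y : QReg 1) (h : x ≠ y) : tGate x y = 0 := by
  simp [tGate, h]

/-- `Z T` is diagonal. [cite: NielsenChuang2010, §4.2] -/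
theorem pauliZ_mul_tGate_off_diag (x y : QReg 1) (h : x ≠ y) : (pauliZ * tGate) x y = 0 := by
  have hx : x = fun _ => x 0 := funext fun i => by rw [Subsingleton.elim i 0]
  have hy : y = fun _ => y 0 := funext fun i => by rw [Subsingleton.elim i 0]
  have hne : x 0 ≠ y 0 := fun h' => h (by rw [hx, hy, h'])
  rw [hx, hy, pauliZ_mul_tGate_apply_const, if_neg hne]

/-- **Catalysis on two qubits, `|A⟩`-branch**: `(CS · CNOT)(1 ⊗ |A⟩⟨A|) = (T ⊗ 1)(1 ⊗ |A⟩⟨A|)`,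
i.e. `CS · CNOT (|ψ⟩ ⊗ |A⟩) = T|ψ⟩ ⊗ |A⟩` for every `|ψ⟩`: the magic state is returned unchanged.
[cite: NielsenChuang2010, §10.6.2 and Ex. 10.68] -/
theorem injectTwo_mul_projA : injectTwo * onSecond projA = tFirst * onSecond projA := by
  apply (Matrix.reindexRingEquiv ℂ qRegTwoEquiv).injective
  simp only [map_mul, Matrix.coe_reindexRingEquiv, reindex_injectTwo, reindex_onSecond,
    reindex_onFirst_diag tGate tGate_off_diag, projA_apply, tGate_apply_const]
  ext i j
  fin_cases i <;> fin_cases j <;> simp [Matrix.mul_apply, Fin.sum_univ_four] <;> ring_nf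

/-- **Catalysis on two qubits, `|A⊥⟩`-branch**: `(CS · CNOT)(1 ⊗ |A⊥⟩⟨A⊥|) = (ZT ⊗ 1)(1 ⊗ |A⊥⟩⟨A⊥|)`.
[cite: NielsenChuang2010, §10.6.2 and Ex. 10.68] -/
theorem injectTwo_mul_projAperp : injectTwo * onSecond projAperp = ztFirst * onSecond projAperp := by
  apply (Matrix.reindexRingEquiv ℂ qRegTwoEquiv).injective
  simp only [map_mul, Matrix.coe_reindexRingEquiv, reindex_injectTwo, reindex_onSecond,
    reindex_onFirst_diag (pauliZ * tGate) pauliZ_mul_tGate_off_diag, projAperp_apply,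
    pauliZ_mul_tGate_apply_const]
  ext i j
  fin_cases i <;> fin_cases j <;> simp [Matrix.mul_apply, Fin.sum_univ_four] <;> ring_nf

/-! ### The injection word on an `N`-wire register and the placed catalysis identities -/

/-- **The injection word** on the wires `q ≠ a` (data `q`, catalyst `a`) of an `N`-wire register:
CNOT `q → a`, then controlled-`S` on `q, a` — the placement of `injectTwo`.
[cite: NielsenChuang2010, §10.6.2 and Ex. 10.68] -/
def inject (q a : Fin N) (h : q ≠ a) : Matrix (QReg N) (QReg N) ℂ :=
  placeGate (pairEmb q a h) injectTwo

/-- `inject q a h` is the product "controlled-`S` after the library's placed CNOT". [cite: NielsenChuang2010, §10.6.2] -/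
theorem inject_eq (q a : Fin N) (h : q ≠ a) :
    inject q a h = placeGate (pairEmb q a h) csGate * (cnotOn q a h).toMatrix 0 := by
  rw [inject, injectTwo, placeGate_mul_holds, cnotOn_toMatrix]

/-- The projector `|A⟩⟨A|` on the catalyst wire `a`. [cite: NielsenChuang2010, §2.1.6] -/
abbrev projAAt (a : Fin N) : Matrix (QReg N) (QReg N) ℂ := placeGate (wireEmb a) projA

/-- The projector `|A⊥⟩⟨A⊥|` on the catalyst wire `a`. [cite: NielsenChuang2010, §2.1.6] -/
abbrev projAperpAt (a : Fin N) : Matrix (QReg N) (QReg N) ℂ := placeGate (wireEmb a) projAperp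

/-- A projector on `a` through the pair embedding `(q, a)`. [folklore] -/
theorem placeGate_wireEmb_eq_pair_onSecond (q a : Fin N) (h : q ≠ a) (P : Matrix (QReg 1) (QReg 1) ℂ) :
    placeGate (wireEmb a) P = placeGate (pairEmb q a h) (onSecond P) := by
  rw [placeGate_placeGate, wireEmb_trans, pairEmb_one]

/-- A one-qubit gate on `q` through the pair embedding `(q, a)`. [folklore] -/
theorem placeGate_wireEmb_eq_pair_onFirst (q a : Fin N) (h : q ≠ a) (U : Matrix (QReg 1) (QReg 1) ℂ) :
    placeGate (wireEmb q) U = placeGate (pairEmb q a h) (placeGate (wireEmb (0 : Fin 2)) U) := by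
  rw [placeGate_placeGate, wireEmb_trans, pairEmb_zero]

/-- **Catalysis, `|A⟩`-branch, placed**: on an `N`-wire register,
`inject(q,a) · Π_A(a) = T_q · Π_A(a)`. [cite: NielsenChuang2010, §10.6.2 and Ex. 10.68] -/
theorem inject_mul_projAAt (q a : Fin N) (h : q ≠ a) :
    inject q a h * projAAt a = placeGate (wireEmb q) tGate * projAAt a := by
  rw [projAAt, placeGate_wireEmb_eq_pair_onSecond q a h, placeGate_wireEmb_eq_pair_onFirst q a h, inject,
    ← placeGate_mul_holds, ← placeGate_mul_holds, injectTwo_mul_projA]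

/-- **Catalysis, `|A⊥⟩`-branch, placed**: `inject(q,a) · Π_⊥(a) = (Z T)_q · Π_⊥(a)`.
[cite: NielsenChuang2010, §10.6.2 and Ex. 10.68] -/
theorem inject_mul_projAperpAt (q a : Fin N) (h : q ≠ a) :
    inject q a h * projAperpAt a = placeGate (wireEmb q) (pauliZ * tGate) * projAperpAt a := by
  rw [projAperpAt, placeGate_wireEmb_eq_pair_onSecond q a h, placeGate_wireEmb_eq_pair_onFirst q a h,
    inject, ← placeGate_mul_holds, ← placeGate_mul_holds, injectTwo_mul_projAperp]

/-- The projectors on the catalyst wire commute with every operator placed off that wire.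
[cite: NielsenChuang2010, §4.2] -/
theorem placeGate_comm_wire {k : ℕ} {e : Fin k ↪ Fin N} {a : Fin N} (ha : a ∉ Set.range e)
    (U : Matrix (QReg k) (QReg k) ℂ) (P : Matrix (QReg 1) (QReg 1) ℂ) :
    placeGate e U * placeGate (wireEmb a) P = placeGate (wireEmb a) P * placeGate e U := by
  refine placeGate_comm_of_disjoint_holds e (wireEmb a) ?_ U P
  rw [range_wireEmb, Set.disjoint_singleton_right]
  exact ha

/-- The `T` gate commutes with the projectors on another wire (the right-hand sides of the
catalysis identities in the form `Π · T`). [cite: NielsenChuang2010, §4.2] -/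
theorem placeGate_wireEmb_comm {q a : Fin N} (h : q ≠ a) (U P : Matrix (QReg 1) (QReg 1) ℂ) :
    placeGate (wireEmb q) U * placeGate (wireEmb a) P = placeGate (wireEmb a) P * placeGate (wireEmb q) U :=
  placeGate_comm_wire (by rw [range_wireEmb, Set.mem_singleton_iff]; exact h.symm) U P

/-! ### From gate-by-gate identities to the circuit -/

/-- **Pushing a projector through a product.** If every factor satisfies `M Π = Π N` then
`(∏ M) Π = Π (∏ N)`: the circuit with injection words, restricted to the `|A⟩`-branch of the
catalyst, is the circuit with genuine `T` gates (and with `ZT` gates on the `|A⊥⟩`-branch).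
[cite: NielsenChuang2010, §10.6.2] -/
theorem prod_mul_eq_mul_prod_of_forall₂ {R : Type*} [Monoid R] (P : R) :
    ∀ {l₁ l₂ : List R}, List.Forall₂ (fun M M' => M * P = P * M') l₁ l₂ → l₁.prod * P = P * l₂.prod
  | _, _, List.Forall₂.nil => by simp
  | _, _, List.Forall₂.cons h hl => by
    rw [List.prod_cons, List.prod_cons, mul_assoc, prod_mul_eq_mul_prod_of_forall₂ P hl, ← mul_assoc, h,
      mul_assoc]

/-- The same for products taken in reverse order (the order of `QCircuit.toMatrix`). [folklore] -/
theorem reverse_prod_mul_eq_mul_reverse_prod_of_forall₂ {R : Type*} [Monoid R] (P : R) {l₁ l₂ : List R}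
    (h : List.Forall₂ (fun M M' => M * P = P * M') l₁ l₂) : l₁.reverse.prod * P = P * l₂.reverse.prod :=
  prod_mul_eq_mul_prod_of_forall₂ P (List.forall₂_reverse_iff.2 h)

/-- The injection word contributes `inject · Π_A = Π_A · T` (catalysis plus commutation).
[cite: NielsenChuang2010, §10.6.2 and Ex. 10.68] -/
theorem inject_mul_projAAt_eq_projAAt_mul (q a : Fin N) (h : q ≠ a) :
    inject q a h * projAAt a = projAAt a * placeGate (wireEmb q) tGate := by
  rw [inject_mul_projAAt, projAAt, placeGate_wireEmb_comm h]

/-- The injection word contributes `inject · Π_⊥ = Π_⊥ · (Z T)` on the other branch.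
[cite: NielsenChuang2010, §10.6.2 and Ex. 10.68] -/
theorem inject_mul_projAperpAt_eq_projAperpAt_mul (q a : Fin N) (h : q ≠ a) :
    inject q a h * projAperpAt a = projAperpAt a * placeGate (wireEmb q) (pauliZ * tGate) := by
  rw [inject_mul_projAperpAt, projAperpAt, placeGate_wireEmb_comm h]

end Lemma24

end Literature.Computability.QuantumComplexity

end
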